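import Mathlib
import HarnessLib
import Summits.NavierStokesRegularity.NavierStokesRegularity.Theorems.TypeILiouvilleLambTailFading

/-!
# TypeILiouvilleLambTailStrain — crux (L) stmt-NavierStokesRegularity-10661 `TypeIliouvilleL`:
# SUMMABLE LAMB TAIL + SUMMABLE STRAIN TAIL ⟹ ONE CONSTANT VECTOR (part 3 of `TypeILiouvilleLambTail`)

Helper for stmt-NavierStokesRegularity-10661 (`--supports`); theorems only, no definitions, no named-fact
hypotheses; closes no item; Navier–Stokes regularity is NOT proved here (leafhand seat of the EulerZoomLiouville route).

Class P, `ω = curl v`, the vortex commutator `f = Dv[ω] − Dω[v] = curl(v × ω)` as in parts 1–2.  The two backward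
DIALS of the tree on print's class are the STRAIN LEDGER `exp ∫_s^t Λ` (`⟪∇v ξ, ξ⟫ ≤ Λ‖ξ‖²`, VE
`TypeILiouvilleStrainLedger.norm_curl_le_mul_exp_integral_strain`: it bounds the AMPLIFICATION of the vorticity from
`s` to `t`) and the LAMB TAIL `∫_{(−∞,s]} φ` (`‖f‖ ≤ φ`, part 2: it bounds the vorticity AT `s`).

* `const_of_integrable_lambTail_of_integrable_strainTail` — ★ **UNCONDITIONAL CELL: if both tails are summable on a
  past half-line — the Lamb tail `∫_{−∞} φ < ∞` and the strain tail `∫_{−∞} Λ` (absolutely) — the flow is ONE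
  CONSTANT VECTOR**: the Lamb tail makes `sup‖ω(s,·)‖ → 0` (`curl_fading_of_integrable_commutator_tail`) while the
  ledger multiplies it by at most `exp ∫_{(−∞,t]} |Λ|`; so `curl v ≡ 0`, then
  `TypeILiouvilleStrainLedger.const_of_curl_eq_zero`.  Neither hypothesis alone is known to suffice (summable strain
  tail alone gives no smallness to amplify; summable Lamb tail alone gives quiescence, part 2); the tree's
  integrable-GRADIENT cell (`TypeILiouvilleStrainLedger.const_of_integrable_gradient_tail`, `‖∇v‖ ≤ g` summable) is a
  different cell: `‖∇v‖` dominates `Λ` but not the commutator's transport part `Dω[v]`.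
* `const_of_integrable_lambTail_of_integrable_norm_fderiv_tail` — the same with the plain gradient majorant
  `‖∇v(τ,x)‖ ≤ g τ` in place of `Λ` (Cauchy–Schwarz), for by-name use next to the Starved file.

READING for the residual L_Q: a quiescent non-constant member of class P with summable Lamb tail must have a
NON-SUMMABLE positive-strain tail `∫_{−∞} sup_x λ_max(S) = +∞` although `sup_x‖∇v(τ,·)‖ → 0`.
HONEST LABEL: classical estimates on print's class; nothing here proves a registered stub, (L), or Navier–Stokes
regularity; rung 0.
[cite: MajdaBertozziCUP2002, eq. (3.80)] [cite: KochNadirashviliSereginSverak2009, §4 (i), Lemma 6.1, Remark 6.1 (arXiv:0709.3599)]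
-/

noncomputable section
open MeasureTheory Filter Set Function Metric
open scoped Topology ENNReal RealInnerProductSpace Laplacian ContDiff
open Literature.Analysis Literature.Analysis.FluidPDE Literature.Analysis.UnboundedOperators
set_option linter.dupNamespace false
namespace Summit.NavierStokesRegularity.NavierStokesRegularity.Theorems.TypeILiouvilleLambTail

/-- ★ **SUMMABLE LAMB TAIL + SUMMABLE STRAIN TAIL ⟹ ONE CONSTANT VECTOR (unconditional).**  Let `v` be a class-P flow
with a continuous strain majorant `⟪∇v(τ,x)ξ, ξ⟫ ≤ Λ τ ‖ξ‖²` (`τ < 0`) integrable on some `(−∞,t₁]`, and a continuous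
majorant `‖Dv[ω] − Dω[v]‖(τ,x) ≤ φ τ` of its vortex commutator integrable on some `(−∞,t₀]`.  Then `v` is constant:
for `t < 0`, `η > 0` pick `s < t` in the fading regime `sup‖ω(s,·)‖ ≤ η` (part 2); VE on `[s,t]` gives
`‖ω(t,x)‖ ≤ η · exp ∫_s^t Λ ≤ η · exp ∫_{(−∞,t]} |Λ|`; `η → 0`.
[cite: MajdaBertozziCUP2002, eq. (3.80)] [cite: KochNadirashviliSereginSverak2009, §4 (i), Remark 6.1 (arXiv:0709.3599)] -/
theorem const_of_integrable_lambTail_of_integrable_strainTail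
    {v : ℝ → EuclideanSpace ℝ (Fin 3) → EuclideanSpace ℝ (Fin 3)}
    (hc : ContinuousOn (uncurry v) (Iio 0 ×ˢ univ))
    (hK : ∃ K : ℝ, ∀ t < 0, ∀ x, ‖v t x‖ ≤ K)
    (hd : ∀ t < 0, IsWeaklyDivFree (v t))
    (hm : ∀ s t : ℝ, s < t → t < 0 → ∀ x,
      v t x = heatExtension (v s) (t - s) x - oseenDuhamel 1 s v v t x)
    {Λ : ℝ → ℝ} (hΛc : Continuous Λ)
    (hΛ : ∀ τ < 0, ∀ x ξ : EuclideanSpace ℝ (Fin 3), ⟪fderiv ℝ (v τ) x ξ, ξ⟫ ≤ Λ τ * ‖ξ‖ ^ 2)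
    {t₁ : ℝ} (hΛint : IntegrableOn Λ (Iic t₁))
    {φ : ℝ → ℝ} (hφc : Continuous φ)
    (hφ : ∀ τ < 0, ∀ x : EuclideanSpace ℝ (Fin 3),
      ‖fderiv ℝ (v τ) x (curl (v τ) x) - fderiv ℝ (curl (v τ)) x (v τ x)‖ ≤ φ τ)
    {t₀ : ℝ} (hint : IntegrableOn φ (Iic t₀)) :
    ∃ b : EuclideanSpace ℝ (Fin 3), ∀ t < 0, ∀ x, v t x = b := by
  have hfade := curl_fading_of_integrable_commutator_tail hc hK hd hm hφc hφ hint
  refine TypeILiouvilleStrainLedger.const_of_curl_eq_zero hc hK hd hm fun t ht x => ?_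
  -- integrability of `Λ` on `(−∞, t]`
  have hΛt : IntegrableOn Λ (Iic t) := by
    rcases le_or_gt t t₁ with h | h
    · exact hΛint.mono_set (Iic_subset_Iic.2 h)
    · have h2 : IntegrableOn Λ (Icc t₁ t) := hΛc.continuousOn.integrableOn_Icc
      have hun : Iic t = Iic t₁ ∪ Icc t₁ t := by
        ext τ; simp only [mem_Iic, mem_union, mem_Icc]
        constructor
        · intro hτ; rcases le_or_gt τ t₁ with h' | h'
          · exact Or.inl h'
          · exact Or.inr ⟨h'.le, hτ⟩
        · rintro (h' | h'); exacts [h'.trans h.le, h'.2]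
      rw [hun]; exact hΛint.union h2
  -- the VE exponent on any window `[s,t]` is at most `M = ∫_{(−∞,t]} |Λ|`
  set M : ℝ := ∫ τ in Iic t, |Λ τ| with hM
  have hexp : ∀ s < t, ∫ τ in s..t, Λ τ ≤ M := by
    intro s hst
    rw [intervalIntegral.integral_of_le hst.le]
    have h1 : ∫ τ in Ioc s t, Λ τ ≤ ∫ τ in Ioc s t, |Λ τ| :=
      setIntegral_mono (hΛt.mono_set Ioc_subset_Iic_self) ((hΛt.mono_set Ioc_subset_Iic_self).abs)
        fun τ => le_abs_self _
    have h2 : ∫ τ in Ioc s t, |Λ τ| ≤ M :=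
      setIntegral_mono_set hΛt.abs (ae_of_all _ fun τ => abs_nonneg _) Ioc_subset_Iic_self.eventuallyLE
    exact h1.trans h2
  -- `‖ω(t,x)‖ ≤ η e^M` for every `η > 0`
  have hkey : ∀ η : ℝ, 0 < η → ‖curl (v t) x‖ ≤ η * Real.exp M := by
    intro η hη
    obtain ⟨T, -, hT⟩ := hfade η hη
    set s : ℝ := min t T - 1 with hs
    have hst : s < t := by have := min_le_left t T; rw [hs]; linarith
    have hsT : s < T := by have := min_le_right t T; rw [hs]; linarith
    have hΩ : ∀ y, ‖curl (v s) y‖ ≤ η := hT s hsT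
    have h := TypeILiouvilleStrainLedger.norm_curl_le_mul_exp_integral_strain hc hK hd hm hst ht hΛc
      (fun τ hτ y ξ => hΛ τ (lt_of_le_of_lt hτ.2 ht) y ξ) hΩ x
    exact h.trans (mul_le_mul_of_nonneg_left (Real.exp_le_exp.2 (hexp s hst)) hη.le)
  have hle : ‖curl (v t) x‖ ≤ 0 := by
    refine le_of_forall_pos_le_add fun ε hε => ?_
    have hpos : 0 < Real.exp M := Real.exp_pos _
    have h := hkey (ε / Real.exp M) (div_pos hε hpos)
    rw [div_mul_cancel₀ ε hpos.ne'] at h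
    linarith
  exact norm_le_zero_iff.1 hle

/-- **The same with the plain gradient majorant** `‖∇v(τ,x)‖ ≤ g τ` (`τ < 0`, continuous `g` integrable on a past
half-line) in place of the strain majorant (Cauchy–Schwarz `⟪∇v ξ, ξ⟫ ≤ ‖∇v‖‖ξ‖²`): summable Lamb tail + summable gradient
tail ⟹ constant.  (The gradient-tail hypothesis ALONE already suffices —
`TypeILiouvilleStrainLedger.const_of_integrable_gradient_tail`; recorded for by-name comparison of the two cells.)
[cite: MajdaBertozziCUP2002, eq. (3.80)] -/
theorem const_of_integrable_lambTail_of_integrable_norm_fderiv_tail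
    {v : ℝ → EuclideanSpace ℝ (Fin 3) → EuclideanSpace ℝ (Fin 3)}
    (hc : ContinuousOn (uncurry v) (Iio 0 ×ˢ univ))
    (hK : ∃ K : ℝ, ∀ t < 0, ∀ x, ‖v t x‖ ≤ K)
    (hd : ∀ t < 0, IsWeaklyDivFree (v t))
    (hm : ∀ s t : ℝ, s < t → t < 0 → ∀ x,
      v t x = heatExtension (v s) (t - s) x - oseenDuhamel 1 s v v t x)
    {g : ℝ → ℝ} (hgc : Continuous g)
    (hg : ∀ τ < 0, ∀ x : EuclideanSpace ℝ (Fin 3), ‖fderiv ℝ (v τ) x‖ ≤ g τ)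
    {t₁ : ℝ} (hgint : IntegrableOn g (Iic t₁))
    {φ : ℝ → ℝ} (hφc : Continuous φ)
    (hφ : ∀ τ < 0, ∀ x : EuclideanSpace ℝ (Fin 3),
      ‖fderiv ℝ (v τ) x (curl (v τ) x) - fderiv ℝ (curl (v τ)) x (v τ x)‖ ≤ φ τ)
    {t₀ : ℝ} (hint : IntegrableOn φ (Iic t₀)) :
    ∃ b : EuclideanSpace ℝ (Fin 3), ∀ t < 0, ∀ x, v t x = b := by
  refine const_of_integrable_lambTail_of_integrable_strainTail hc hK hd hm hgc (fun τ hτ y ξ => ?_) hgint hφc hφ hint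
  calc ⟪fderiv ℝ (v τ) y ξ, ξ⟫ ≤ ‖fderiv ℝ (v τ) y ξ‖ * ‖ξ‖ := real_inner_le_norm _ _
    _ ≤ (‖fderiv ℝ (v τ) y‖ * ‖ξ‖) * ‖ξ‖ :=
        mul_le_mul_of_nonneg_right (ContinuousLinearMap.le_opNorm _ _) (norm_nonneg _)
    _ ≤ (g τ * ‖ξ‖) * ‖ξ‖ :=
        mul_le_mul_of_nonneg_right (mul_le_mul_of_nonneg_right (hg τ hτ y) (norm_nonneg _)) (norm_nonneg _)
    _ = g τ * ‖ξ‖ ^ 2 := by ring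

end Summit.NavierStokesRegularity.NavierStokesRegularity.Theorems.TypeILiouvilleLambTail

end
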